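import Summits.BirchSwinnertonDyer.BirchSwinnertonDyer.Theses.TameQuarticManinParity
import Summits.BirchSwinnertonDyer.Rank1Residual.Additive.KodairaDictionaryThree
import Literature.NumberTheory.EllipticCurves.ThreeTorsionIrreducibleInertiaShapeKodairaThreeProofs
import Literature.NumberTheory.Automorphic.BCDTModularityModPProofs
import Literature.NumberTheory.EllipticCurves.HasseWeilGoodReductionProofs
import Literature.NumberTheory.ModularSymbols.CuspidalHomologyShiftNorm
import HarnessLib
import Literature.NumberTheory.EllipticCurves.ModularJacobianNormImageSerreWeight

/-!
# Route `TameQuarticManinParity`, stub H1 `TprimeIrrNormImageAvoidsThree` (stmt-BirchSwinnertonDyer-23479) from ONE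
# named fact: irreducible mod-`3` systems occurring in the `t`-norm image `NmΛ ⊗ 𝔽₃ ⊂ H₁(X₀(N), 𝔽₃)` (`9 ∣ N`) —
# the level-`N/3` part — have Serre weight `≤ 4`

Lead seat `cruxlead-stmt-BirchSwinnertonDyer-23367` g0, line `abelian-fixed-points`. H1 is the level-`N/3` support
statement of the pen's LINE 29. It is proved here CONDITIONALLY on the named fact
`normImage_modThree_serreWeight_le_four` (stated inline for the gate to relocate under `Literature/`): a print assembly
of (i) `NmΛ = π^*π_*Λ ≅ π_*Λ ⊆ H₁(X₀(N/3), ℤ)` Hecke-equivariantly for `p ≠ 3` (Harrison 2011 §2; Atkin–Lehner), so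
mod-`3` systems of `NmΛ/3Λ_B` are mod-`3` systems of weight `2` and level `N/3` (Brauer–Nesbitt for lattices);
(ii) Eichler–Shimura/Deligne–Serre: such a system is `(tr ρ̄_g(Frob_p))` for an eigenform `g` of level `N/3`, and an
irreducible `ρ̄` with the same traces on a large finite set `S₀` is `ρ̄_g` (Chebotarev, Brauer–Nesbitt);
(iii) Darmon–Diamond–Taylor Thm. 3.1 (f),(g) p. 86: `9 ∤ N/3`, so `ρ_g|G₃` is finite flat (`3 ∤ N/3`) or ordinary
(`3 ∥ N/3`, `ℓ = 3` odd), whence `k(ρ̄) ∈ {2, 4}` by Serre's recipe (Serre 1987 §2; Ribet–Stein §2.1–2.2). Against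
it: `k(ρ̄_{W,3}) = 6` on Kodaira-III rows (tree theorem `serreWeight_three_eq_six_of_kodairaSymbolAt_III`). No
multiplicity one is used. THEOREMS + one inline named-fact `def`; no `sorry`; conditional result; BSD is NOT proved.
-/

set_option autoImplicit false
-- D-0017: single-problem summit, so `Summit.BirchSwinnertonDyer.BirchSwinnertonDyer.…` repeats a namespace BY DESIGN.
set_option linter.dupNamespace false

noncomputable section

open scoped NumberField Polynomial Valued
open Polynomial IsDedekindDomain NumberField Field ValuativeRel
open Literature.NumberTheory.EllipticCurves.ModularForms Literature.NumberTheory.ModularSymbols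
open Literature.NumberTheory.GaloisRepresentations Rat.HeightOneSpectrum
open Literature.NumberTheory.GaloisRepresentations.IsNonarchimedeanLocalField

namespace Summit.BirchSwinnertonDyer.BirchSwinnertonDyer.Theorems.TameQuarticManinParity

/-- **H1 ⟸ the named fact**: `TprimeIrrNormImageAvoidsThree` (stmt-BirchSwinnertonDyer-23479) holds granted
`normImage_modThree_serreWeight_le_four`: take `ρ̄ = ρ̄_{W,3}` (framed, `exists_isTorsionGaloisRep`), irreducible by
the binder `HasIrreducibleModPGaloisRep 3`, with traces `a_p(W)` (`IsTorsionGaloisRep.charpoly_eq_of_isArithFrobAt`);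
the fact's `S₀` is the `S` of H1: if `Nm z ∉ 3Λ` the fact yields a datum with `k ≤ 4`, while the Kodaira-III row has
`k = 6` at every datum (`serreWeight_three_eq_six_of_kodairaSymbolAt_III`; III from `SubTprime` and `v₃(Δ) = 3`).
CONDITIONAL result. [cite: DarmonDiamondTaylor1995, Thm. 3.1 (f),(g) (p. 86)] -/
theorem normImageAvoidsThree_of_serreWeightFact (hF : Literature.NumberTheory.EllipticCurves.normImage_modThree_serreWeight_le_four) :
    Theses.TameQuarticManinParity.TprimeIrrNormImageAvoidsThree := by
  intro W _ _ _ hCM hA hS hirr hv h9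
  classical
  haveI : Fact (Nat.Prime 3) := ⟨Nat.prime_three⟩
  haveI : NeZero ((3 : ℕ) : ℚ) := ⟨by norm_num⟩
  obtain ⟨ρ, hρ⟩ := WeierstrassCurve.exists_isTorsionGaloisRep W 3
  obtain ⟨e, he⟩ := id hρ
  -- irreducibility of the framed representation: no `ρ̄`-stable line
  have hirrρ : ∀ L : Submodule (ZMod 3) (Fin 2 → ZMod 3),
      (∀ (g : Field.absoluteGaloisGroup ℚ) (x : Fin 2 → ZMod 3), x ∈ L →
        ((ρ g : GL (Fin 2) (ZMod 3)) : Matrix (Fin 2) (Fin 2) (ZMod 3)).mulVec x ∈ L) → L = ⊥ ∨ L = ⊤ := by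
    intro L hstab
    set H : AddSubgroup (WeierstrassCurve.geomTorsion W 3) := L.toAddSubgroup.comap e.toAddMonoidHom with hHdef
    have hHmem : ∀ P, P ∈ H ↔ e P ∈ L := fun P ↦ Iff.rfl
    have hH : ∀ σ : Field.absoluteGaloisGroup ℚ, ∀ P ∈ H, σ • P ∈ H := by
      intro σ P hP
      rw [hHmem] at hP ⊢
      rw [he]
      exact hstab σ _ hP
    rcases hirr H hH with hbot | htop
    · left
      rw [eq_bot_iff]
      intro x hx
      have hx' : e.symm x ∈ H := by rw [hHmem, AddEquiv.apply_symm_apply]; exact hx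
      rw [hbot, AddSubgroup.mem_bot] at hx'
      rw [Submodule.mem_bot, ← e.apply_symm_apply x, hx', map_zero]
    · right
      rw [eq_top_iff]
      intro x _
      have hx' : e.symm x ∈ H := by rw [htop]; exact AddSubgroup.mem_top _
      rw [hHmem, AddEquiv.apply_symm_apply] at hx'
      exact hx'
  -- the Frobenius characteristic polynomials `X² − a_p(W) X + p`
  have htr : ∀ (v : HeightOneSpectrum (𝓞 ℚ)), ¬ ((primesEquiv v : Nat.Primes) : ℕ) ∣ 3 * W.conductorNorm ℤ →
      ∀ 𝔓 ∈ v.primesAbove, ∀ φ : Field.absoluteGaloisGroup ℚ, IsArithFrobAt (𝓞 ℚ) φ 𝔓 →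
        ((ρ φ : GL (Fin 2) (ZMod 3)) : Matrix (Fin 2) (Fin 2) (ZMod 3)).charpoly =
          X ^ 2 - C ((W.LFunction ((primesEquiv v : Nat.Primes) : ℕ) : ℤ) : ZMod 3) * X +
            C ((((primesEquiv v : Nat.Primes) : ℕ) : ℕ) : ZMod 3) := by
    intro v hv3N 𝔓 h𝔓 φ hφ
    have hpp : ((primesEquiv v : Nat.Primes) : ℕ).Prime := (primesEquiv v).2
    have hp3 : ((primesEquiv v : Nat.Primes) : ℕ) ≠ 3 := fun h ↦ hv3N (by rw [h]; exact dvd_mul_right 3 _)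
    have hpN : ¬ ((primesEquiv v : Nat.Primes) : ℕ) ∣ W.conductorNorm ℤ := fun h ↦ hv3N (dvd_mul_of_dvd_right h 3)
    have hgood : W.HasGoodReductionAt v := by
      by_contra h
      exact hpN ((W.dvd_conductorNorm_iff v).mpr h)
    have hℓv : ((3 : ℕ) : 𝓞 ℚ) ∉ v.asIdeal := by
      rw [Literature.NumberTheory.GaloisRepresentations.Rat.natCast_mem_asIdeal_iff]
      exact fun h ↦ hp3 ((Nat.prime_dvd_prime_iff_eq hpp Nat.prime_three).mp h)
    have hch := hρ.charpoly_eq_of_isArithFrobAt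
      (W.trace_galoisRepTate_frobenius_of_hasGoodReductionAt_holds 3)
      (W.det_galoisRepTate_frobenius_of_hasGoodReductionAt_holds 3) hℓv hgood h𝔓 hφ
    rw [WeierstrassCurve.natCard_residueField_adicCompletionIntegers,
      ← W.lFunction_primesEquiv_eq_frobeniusTraceAt hgood] at hch
    exact hch
  obtain ⟨S₀, hS₀⟩ := hF (W.conductorNorm ℤ) h9 ρ hirrρ (fun n ↦ W.LFunction n) htr
  refine ⟨S₀, fun z hz ↦ ?_⟩
  by_contra hnot
  -- the fact yields a datum of Serre weight `≤ 4` …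
  letI : TopologicalSpace (AlgebraicClosure (ZMod 3)) := ⊥
  haveI : DiscreteTopology (AlgebraicClosure (ZMod 3)) := ⟨rfl⟩
  haveI : CharP (AlgebraicClosure (ZMod 3)) 3 :=
    charP_of_injective_algebraMap (algebraMap (ZMod 3) (AlgebraicClosure (ZMod 3))).injective 3
  obtain ⟨loc, ι, hle⟩ := hS₀ ⟨z, hnot, fun p hp hp3 hpS ↦ hz p hp hp3 hpS⟩ (AlgebraicClosure (ZMod 3))
    (algebraMap (ZMod 3) (AlgebraicClosure (ZMod 3))) continuous_of_discreteTopology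
  -- … while the Kodaira-III row has Serre weight `6` at every datum
  have hK : W.kodairaSymbolAt (Rank1Residual.Additive.placeOf 3) = .III := by
    have hIII := (Rank1Residual.Additive.subTprime_three_iff_kodairaSymbolAt_III_or_IIIstar W hA).mp hS
    rcases hIII with h | h
    · exact h
    · exfalso
      have h2 : ringChar (ℤ ⧸ (Rank1Residual.Additive.placeOf 3).asIdeal) ≠ 2 := by
        rw [Rank1Residual.Additive.ringChar_int_quot_placeOf 3]; decide
      haveI : PerfectField (IsLocalRing.ResidueField
          ((Rank1Residual.Additive.placeOf 3).adicCompletionIntegers ℚ)) := PerfectField.ofFinite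
      have hord := W.ordMinimalDiscriminant_eq_numComponentsAt_add_one_of_kodairaSymbolAt
        (Rank1Residual.Additive.placeOf 3) h2 (Or.inr (Or.inl h))
      rw [Rank1Residual.Additive.ordMinimalDiscriminant_placeOf_eq W 3, hv] at hord
      unfold WeierstrassCurve.numComponentsAt at hord
      rw [h] at hord
      simp only [Literature.NumberTheory.DiophantineGeometry.KodairaSymbol.numComponents] at hord
      omega
  have hvp : ((primesEquiv (R := ℤ) (Rank1Residual.Additive.placeOf 3) : Nat.Primes) : ℕ) = 3 :=
    congrArg Subtype.val ((primesEquiv (R := ℤ)).apply_symm_apply ⟨3, Nat.prime_three⟩)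
  have h6 := Literature.NumberTheory.EllipticCurves.ThreeTorsionIrreducibleShape.serreWeight_three_eq_six_of_kodairaSymbolAt_III
    W (Rank1Residual.Additive.placeOf 3) hvp hK hρ (algebraMap (ZMod 3) (AlgebraicClosure (ZMod 3)))
    continuous_of_discreteTopology loc ι
  omega

end Summit.BirchSwinnertonDyer.BirchSwinnertonDyer.Theorems.TameQuarticManinParity

end
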